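import Literature.NumberTheory.Transcendental.RoySmallValueProp64
import Literature.NumberTheory.Transcendental.RoySmallValueLevels
import Literature.NumberTheory.Transcendental.RoySmallValueZeros
import Literature.NumberTheory.Transcendental.RoySmallValueStep2Select
import HarnessLib

/-!
# Roy's small value estimate for `𝔾ₐ × 𝔾ₘ` — Step 3: the orbit `Z` seen at the degree `D* + 1`

Topic `Literature/NumberTheory/Transcendental`. Part of the formalisation of the proof of Roy 2013,
Theorem 1.1 (named fact `roy2013_thm_1_1`, `RoySmallValueEstimates.lean`). Source: D. Roy,
*A small value estimate for `𝔾ₐ × 𝔾ₘ`*, Mathematika 59 (2013) 333–363 = arXiv:1301.0663, §7,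
Step 3 (p. 18 of the arXiv text) and §6 (Lemma 6.3, Proposition 6.4):

> Denote by `D*` the smallest positive integer for which
> `Z ⊆ 𝒵(𝒟ⁱP̃_{D*+1} ; 0 ≤ i < 2⌊(D*+1)^τ⌋)`. [...] by Proposition 6.4, we conclude that
> `deg(Z) ≤ (D*+1)²/⌊(D*+1)^τ⌋` and `h(Z) ≤ 6(D*+1)^{1+β}/⌊(D*+1)^τ⌋` [...]
> (Lemma 6.3) [...] either `Z(ℂ)` is contained in the open set `𝒢` of `ℙ²(ℂ)` or it consists of
> one of the points `(0:1:0)` or `(0:0:1)`.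

The orbit `O` selected at the degree `D` (an orbit of the configuration of `𝒵(P̃_D, Q_D)`) is,
when its points are common zeros of `P̃' = P̃_{D'}` and `Q' = Q_{D'}` (`D' = D* + 1`), ALSO an orbit
of the configuration of `𝒵(P̃', Q')` over the same field `K` (`exists_orbit_transport`: canonical
normalisation makes the identification of points literal, and conjugation is computed from the
same `K`-representatives). We then run Proposition 6.4 there and express the outcome with the
data of `O` (`prop_6_4_transported`): `T' #O ≤ D'²` and `T' D' ∑_{j∈O} h_K(a_j) ≤ [K:ℚ] log 𝓛(F')`.
The hypotheses "all points of `O` in `𝒢`" and "`P̃', Q' ∈ I^{(α_j, T')}`" are derived from the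
vanishing of `𝒟ⁱP̃'` (`i < 2T'`) on `O` (`inG_or_special` via Lemma 6.3, `mem_vanIdeal_of_vanish`).
Everything is proved; no definitions besides the transport map inside proofs; no named facts.

## References

* [Roy2013] D. Roy, *A small value estimate for 𝔾ₐ × 𝔾ₘ*, Mathematika 59 (2013), 333–363
  (arXiv:1301.0663), §7, Step 3; Lemma 6.3; Proposition 6.4.
-/

noncomputable section

open MvPolynomial Finset NumberField Height

namespace Literature.NumberTheory.Transcendental

namespace Roy2013

open Nesterenko

/-! ### Canonically normalised proportional vectors are equal -/

/-- Two proportional vectors, each with first non-zero coordinate equal to `1`, are equal. [folklore] -/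
theorem eq_of_smul_of_normalised {α β : Fin 3 → ℂ} {s : ℂ} (h : α = s • β) {p q : Fin 3}
    (hp1 : α p = 1) (hpmin : ∀ k, α k ≠ 0 → p ≤ k) (hq1 : β q = 1) (hqmin : ∀ k, β k ≠ 0 → q ≤ k) :
    α = β := by
  have hs : s ≠ 0 := by
    intro h0; rw [h0, zero_smul] at h; rw [h] at hp1; exact zero_ne_one hp1
  have hzero : ∀ k, α k = 0 ↔ β k = 0 := fun k => by
    rw [h, Pi.smul_apply, smul_eq_mul, mul_eq_zero, or_iff_right hs]
  have hpq : p = q := by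
    apply le_antisymm
    · exact hpmin q (fun h0 => by rw [(hzero q).mp h0] at hq1; exact zero_ne_one hq1)
    · exact hqmin p (fun h0 => by rw [← hzero p] at h0; rw [h0] at hp1; exact zero_ne_one hp1)
  have hs1 : s = 1 := by
    have h1 := congr_fun h p
    rw [Pi.smul_apply, smul_eq_mul, hp1, hpq, hq1, mul_one] at h1
    exact h1.symm
  rw [h, hs1, one_smul]

/-! ### The transport -/

variable {D₁ D₂ : ℕ} {Pt₁ Pt₂ : MvPolynomial (Fin 3) ℤ} (𝓛₁ : LevelPkg D₁ Pt₁) (𝓛₂ : LevelPkg D₂ Pt₂)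
  {K : IntermediateField ℚ ℂ} [Normal ℚ K] [NumberField K]
  (hK₁ : ∀ i k, 𝓛₁.α i k ∈ K) (hK₂ : ∀ i k, 𝓛₂.α i k ∈ K)

/-- The points of a configuration are pairwise distinct. [folklore] -/
theorem LevelPkg.α_injective {D : ℕ} {Pt : MvPolynomial (Fin 3) ℤ} (𝓛 : LevelPkg D Pt) :
    Function.Injective 𝓛.α := fun i j h => by
  by_contra hne
  exact 𝓛.sep i j hne ⟨1, by rw [one_smul, h]⟩

omit [Normal ℚ K] [NumberField K] in
/-- **Transport of an orbit to another degree.** If the points of the orbit `O` of `𝒵(P̃₁, Q₁)`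
are common zeros of `P̃₂, Q₂`, then `O` is (literally, pointwise) an orbit of the configuration
of `𝒵(P̃₂, Q₂)` over the same field. [cite: Roy2013, §7, Step 3 ("`Z ⊆ 𝒵(𝒟ⁱP̃_{D*+1} ; …)`")] -/
theorem exists_orbit_transport [NumberField K] (i₀ : Fin 𝓛₁.m)
    (hvan : ∀ j ∈ (𝓛₁.cfg K hK₁).orb i₀,
      eval (𝓛₁.α j) (map (Int.castRingHom ℂ) Pt₂) = 0 ∧
      eval (𝓛₁.α j) (map (Int.castRingHom ℂ) (levelQ D₂ Pt₂ 𝓛₂.t)) = 0) :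
    ∃ π : Fin 𝓛₁.m → Fin 𝓛₂.m, (∀ j ∈ (𝓛₁.cfg K hK₁).orb i₀, 𝓛₂.α (π j) = 𝓛₁.α j) ∧
      Set.InjOn π ((𝓛₁.cfg K hK₁).orb i₀) ∧
      (𝓛₂.cfg K hK₂).orb (π i₀) = ((𝓛₁.cfg K hK₁).orb i₀).image π := by
  classical
  set Z₁ := 𝓛₁.cfg K hK₁
  set Z₂ := 𝓛₂.cfg K hK₂
  -- pointwise identification
  have hex : ∀ j, ∃ i : Fin 𝓛₂.m, j ∈ Z₁.orb i₀ → 𝓛₂.α i = 𝓛₁.α j := by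
    intro j
    by_cases hj : j ∈ Z₁.orb i₀
    · obtain ⟨i, s, hs⟩ := 𝓛₂.cov (𝓛₁.α j) (𝓛₁.α_ne_zero j) (hvan j hj).1 (hvan j hj).2
      refine ⟨i, fun _ => ?_⟩
      exact (eq_of_smul_of_normalised hs (𝓛₁.piv_one j) (𝓛₁.piv_min j) (𝓛₂.piv_one i)
        (𝓛₂.piv_min i)).symm
    · haveI : Nonempty (Fin 𝓛₂.m) := by
        obtain ⟨i, -, -⟩ := 𝓛₂.cov (𝓛₁.α i₀) (𝓛₁.α_ne_zero i₀) (hvan i₀ (Z₁.self_mem_orb i₀)).1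
          (hvan i₀ (Z₁.self_mem_orb i₀)).2
        exact ⟨i⟩
      exact ⟨Classical.arbitrary _, fun h => absurd h hj⟩
  choose π hπ using hex
  have hinj : Set.InjOn π (Z₁.orb i₀) := by
    intro j hj j' hj' h
    apply 𝓛₁.α_injective
    rw [← hπ j hj, ← hπ j' hj', h]
  -- the `K`-representatives agree
  have hrep : ∀ j ∈ Z₁.orb i₀, Z₂.rep (π j) = Z₁.rep j := fun j hj => by
    funext k; apply Subtype.ext
    change 𝓛₂.α (π j) k = 𝓛₁.α j k
    rw [hπ j hj]
  have himg : ∀ j ∈ Z₁.orb i₀, ∀ g : K ≃ₐ[ℚ] K, Z₂.img g (π j) = Z₁.img g j := fun j hj g => by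
    funext k
    change ((g (Z₂.rep (π j) k) : K) : ℂ) = ((g (Z₁.rep j k) : K) : ℂ)
    rw [hrep j hj]
  refine ⟨π, hπ, hinj, ?_⟩
  ext x
  simp only [mem_image]
  constructor
  · intro hx
    obtain ⟨-, g, rfl⟩ := mem_filter.mp hx
    -- `Z₂.perm g (π i₀)` is `π (Z₁.perm g i₀)`
    have h1 : Z₁.perm g i₀ ∈ Z₁.orb i₀ := Z₁.perm_mem_orb (Z₁.self_mem_orb i₀) g
    refine ⟨Z₁.perm g i₀, h1, ?_⟩
    apply 𝓛₂.α_injective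
    change Z₂.α (π (Z₁.perm g i₀)) = Z₂.α (Z₂.perm g (π i₀))
    rw [← Z₂.img_eq g (π i₀), himg i₀ (Z₁.self_mem_orb i₀), Z₁.img_eq g i₀]
    exact hπ _ h1
  · rintro ⟨j, hj, rfl⟩
    obtain ⟨-, g, rfl⟩ := mem_filter.mp hj
    refine mem_filter.mpr ⟨mem_univ _, g, ?_⟩
    apply 𝓛₂.α_injective
    change Z₂.α (Z₂.perm g (π i₀)) = Z₂.α (π (Z₁.perm g i₀))
    rw [← Z₂.img_eq g (π i₀), himg i₀ (Z₁.self_mem_orb i₀), Z₁.img_eq g i₀]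
    exact (hπ _ hj).symm

/-! ### `𝒢`-membership and the charts -/

/-- A normalised representative with `α₀ = 0` outside `𝒢` is `(0,1,0)` or `(0,0,1)`. [folklore] -/
theorem eq_special_of_zero {α : Fin 3 → ℂ} {p : Fin 3} (hp1 : α p = 1)
    (hpmin : ∀ k, α k ≠ 0 → p ≤ k) (h : (α 0 = 0 ∧ α 2 = 0) ∨ (α 0 = 0 ∧ α 1 = 0)) :
    α = ![0, 1, 0] ∨ α = ![0, 0, 1] := by
  rcases h with ⟨h0, h2⟩ | ⟨h0, h1⟩
  · left
    have hp : p = 1 := by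
      fin_cases p
      · exact absurd hp1 (by rw [show α ⟨0, by norm_num⟩ = α 0 from rfl, h0]; exact zero_ne_one)
      · rfl
      · exact absurd hp1 (by rw [show α ⟨2, by norm_num⟩ = α 2 from rfl, h2]; exact zero_ne_one)
    subst hp
    funext k; fin_cases k
    · exact h0
    · exact hp1
    · exact h2
  · right
    have hp : p = 2 := by
      fin_cases p
      · exact absurd hp1 (by rw [show α ⟨0, by norm_num⟩ = α 0 from rfl, h0]; exact zero_ne_one)
      · exact absurd hp1 (by rw [show α ⟨1, by norm_num⟩ = α 1 from rfl, h1]; exact zero_ne_one)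
      · rfl
    subst hp
    funext k; fin_cases k
    · exact h0
    · exact h1
    · exact hp1

/-- **Points of `O` are in `𝒢` or special** (Lemma 6.3): if `𝒟ⁱP̃'(α_j) = 0` for `i ≤ D'` with
`X₀ ∤ P̃'`, `X₂ ∤ P̃'`, then `α_j ∈ 𝒢 = {x₀x₂ ≠ 0}` or `α_j ∈ {(0,1,0), (0,0,1)}`.
[cite: Roy2013, Lemma 6.3 and §6, proof of Prop. 6.4] -/
theorem inG_or_special {D : ℕ} {P : CX} (hP : P.IsHomogeneous D) (hX0 : ¬X 0 ∣ P) (hX2 : ¬X 2 ∣ P)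
    {α : Fin 3 → ℂ} {p : Fin 3} (hp1 : α p = 1) (hpmin : ∀ k, α k ≠ 0 → p ≤ k)
    (hvan : ∀ i ≤ D, aeval α (homD^[i] P) = 0) :
    (α 0 ≠ 0 ∧ α 2 ≠ 0) ∨ α = ![0, 1, 0] ∨ α = ![0, 0, 1] := by
  rcases lemma_6_3 hP hX0 hX2 hvan with h | h
  · exact Or.inl h
  · exact Or.inr (eq_special_of_zero hp1 hpmin h)

/-- The special points are far from `(1:γ)`: `dist ≥ 1/c₂ > (2c₂)⁻¹`. [folklore] -/
theorem not_pdist_le_of_special (ξ η : ℂ) {α : Fin 3 → ℂ} (h : α = ![0, 1, 0] ∨ α = ![0, 0, 1]) :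
    ¬pdist ξ η α ≤ (2 * roy_c2 ξ η)⁻¹ := by
  have hc := one_le_roy_c2 ξ η
  have hc0 : 0 < roy_c2 ξ η := by linarith
  intro hle
  have h1 : (1 : ℝ) / roy_c2 ξ η ≤ pdist ξ η α := by
    rw [pdist, div_le_div_iff_of_pos_right hc0]
    rcases h with rfl | rfl
    · refine le_trans ?_ (le_max_left _ _)
      refine le_trans ?_ (le_max_left _ _)
      simp
    · refine le_trans ?_ (le_max_left _ _)
      refine le_trans ?_ (le_max_right _ _)
      simp
  have h2 : (2 * roy_c2 ξ η)⁻¹ < 1 / roy_c2 ξ η := by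
    rw [one_div, inv_lt_inv₀ (by positivity) hc0]; linarith
  linarith

/-- **The charts**: if `𝒟ⁱP̃'(α) = 0` for `i < 2T'`, `D' ≤ T'`, and `α₀ ≠ 0`, then `P̃'` and
`Q' = ∑_{i=1}^{D'} tⁱ𝒟ⁱP̃'` lie in `I^{(α, T')}` (in the chart `x₀ = 1`).
[cite: Roy2013, §6, proof of Prop. 6.4 ("`P` and `Q` also belong to `I^{(α,T)}_D`")] -/
theorem mem_vanIdeal_of_vanish {D T : ℕ} {P : CX} (hP : P.IsHomogeneous D) (hDT : D ≤ T)
    {α : Fin 3 → ℂ} (hα0 : α 0 ≠ 0) (hvan : ∀ i < 2 * T, aeval α (homD^[i] P) = 0) (t : ℕ) :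
    P ∈ vanIdeal (α 1 / α 0) (α 2 / α 0) T ∧
      (∑ i ∈ Icc 1 D, ((t : ℂ) ^ i) • homD^[i] P) ∈ vanIdeal (α 1 / α 0) (α 2 / α 0) T := by
  constructor
  · rw [mem_vanIdeal_iff_of_ne_zero hP hα0]
    intro i hi
    exact hvan i (by omega)
  · have hQ : (∑ i ∈ Icc 1 D, ((t : ℂ) ^ i) • homD^[i] P).IsHomogeneous D := by
      refine IsHomogeneous.sum _ _ _ fun i _ => ?_
      rw [smul_eq_C_mul]
      simpa using (isHomogeneous_C (Fin 3) ((t : ℂ) ^ i)).mul (isHomogeneous_iterate_homD hP i)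
    rw [mem_vanIdeal_iff_of_ne_zero hQ hα0]
    intro k hk
    change aeval α (homD^[k] (∑ i ∈ Icc 1 D, ((t : ℂ) ^ i) • homD^[i] P)) = 0
    rw [iterate_homD_sum, map_sum]
    refine Finset.sum_eq_zero fun i hi => ?_
    rw [mem_Icc] at hi
    rw [iterate_homD_smul, map_smul, ← Function.iterate_add_apply, hvan (k + i) (by omega),
      smul_zero]

/-! ### Proposition 6.4 transported -/

include hK₂ in
/-- **Roy 2013, Proposition 6.4 for the orbit `O` at the degree `D'`.** With the identification
of `exists_orbit_transport`, if `𝒟ⁱP̃'` (`i < 2T'`) vanish on `O`, `X₀ ∤ P̃'`, `X₂ ∤ P̃'`, `D' ≤ T'`,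
all points of `O` satisfy `dist(α^u,(1:γ))`-smallness is NOT needed here — instead we assume the
points of `O` lie in `𝒢` — then `T' #O ≤ D'²` and `T' D' ∑_{j∈O} h_K(a_j) ≤ [K:ℚ] log 𝓛(F')`.
[cite: Roy2013, Proposition 6.4 and §7, Step 3] -/
theorem prop_6_4_transported (i₀ : Fin 𝓛₁.m) {T' L' : ℕ}
    (hT₁ : (L' + 1).choose 2 < T') (hT₂ : T' ≤ (L' + 2).choose 2) (hLD : L' < D₂) (hDT : D₂ ≤ T')
    (hP₂ : (map (Int.castRingHom ℂ) Pt₂).IsHomogeneous D₂)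
    (hvanD : ∀ j ∈ (𝓛₁.cfg K hK₁).orb i₀, ∀ i < 2 * T',
      aeval (𝓛₁.α j) (homD^[i] (map (Int.castRingHom ℂ) Pt₂)) = 0)
    (hG : ∀ j ∈ (𝓛₁.cfg K hK₁).orb i₀, 𝓛₁.α j 0 ≠ 0 ∧ 𝓛₁.α j 2 ≠ 0) :
    T' * ((𝓛₁.cfg K hK₁).orb i₀).card ≤ D₂ ^ 2 ∧
      (T' : ℝ) * D₂ * ∑ j ∈ (𝓛₁.cfg K hK₁).orb i₀, logHeight ((𝓛₁.cfg K hK₁).rep j) ≤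
        Module.finrank ℚ K * Real.log (l1Norm (royF D₂ 𝓛₂.M₁ 𝓛₂.M₂ 𝓛₂.σ
          (map (Int.castRingHom ℂ) Pt₂) (map (Int.castRingHom ℂ) (levelQ D₂ Pt₂ 𝓛₂.t)))) := by
  classical
  set Z₁ := 𝓛₁.cfg K hK₁
  set Z₂ := 𝓛₂.cfg K hK₂
  -- the points of `O` are common zeros of `P̃₂, Q₂`
  have hvan : ∀ j ∈ Z₁.orb i₀, eval (𝓛₁.α j) (map (Int.castRingHom ℂ) Pt₂) = 0 ∧
      eval (𝓛₁.α j) (map (Int.castRingHom ℂ) (levelQ D₂ Pt₂ 𝓛₂.t)) = 0 := by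
    intro j hj
    have hT0 : 0 < 2 * T' := by omega
    refine ⟨hvanD j hj 0 hT0, ?_⟩
    change aeval (𝓛₁.α j) (map (Int.castRingHom ℂ) (levelQ D₂ Pt₂ 𝓛₂.t)) = 0
    rw [map_levelQ, map_sum]
    refine Finset.sum_eq_zero fun i hi => ?_
    rw [mem_Icc] at hi
    rw [map_smul, hvanD j hj i (by omega), smul_zero]
  obtain ⟨π, hπ, hinj, horb⟩ := exists_orbit_transport 𝓛₁ 𝓛₂ hK₁ hK₂ i₀ hvan
  -- Prop. 6.4 at the level `D₂` for the orbit of `π i₀`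
  have hO : ∀ j ∈ Z₂.orb (π i₀), Z₂.α j 0 ≠ 0 ∧ Z₂.α j 2 ≠ 0 ∧
      map (Int.castRingHom ℂ) Pt₂ ∈ vanIdeal (Z₂.α j 1 / Z₂.α j 0) (Z₂.α j 2 / Z₂.α j 0) T' ∧
      map (Int.castRingHom ℂ) (levelQ D₂ Pt₂ 𝓛₂.t) ∈
        vanIdeal (Z₂.α j 1 / Z₂.α j 0) (Z₂.α j 2 / Z₂.α j 0) T' := by
    intro x hx
    rw [horb, mem_image] at hx
    obtain ⟨j, hj, rfl⟩ := hx
    have hαeq : Z₂.α (π j) = 𝓛₁.α j := hπ j hj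
    rw [hαeq]
    obtain ⟨h0, h2⟩ := hG j hj
    have hch := mem_vanIdeal_of_vanish hP₂ hDT h0 (hvanD j hj) 𝓛₂.t
    rw [← map_levelQ] at hch
    exact ⟨h0, h2, hch.1, hch.2⟩
  have h64 := prop_6_4_orbit hP₂ (isHomogeneous_map_levelQ hP₂ 𝓛₂.t) 𝓛₂.hM₁ 𝓛₂.hM₂ 𝓛₂.σ Z₂
    (map_royF 𝓛₂.σ (Int.castRingHom ℂ) Pt₂ (levelQ D₂ Pt₂ 𝓛₂.t)) 𝓛₂.hc 𝓛₂.hFeq 𝓛₂.hesum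
    hT₁ hT₂ hLD (π i₀) hO
  -- transfer the two conclusions
  have hcard : (Z₂.orb (π i₀)).card = (Z₁.orb i₀).card := by
    rw [horb, Finset.card_image_of_injOn hinj]
  have hrep : ∀ j ∈ Z₁.orb i₀, Z₂.rep (π j) = Z₁.rep j := fun j hj => by
    funext k; apply Subtype.ext
    change 𝓛₂.α (π j) k = 𝓛₁.α j k
    rw [hπ j hj]
  have hsum : ∑ j ∈ Z₂.orb (π i₀), logHeight (Z₂.rep j) = ∑ j ∈ Z₁.orb i₀, logHeight (Z₁.rep j) := by
    rw [horb, Finset.sum_image hinj]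
    exact Finset.sum_congr rfl fun j hj => by rw [hrep j hj]
  refine ⟨?_, ?_⟩
  · rw [← hcard, ← 𝓛₂.hcard]; exact h64.1
  · rw [← hsum]; exact h64.2

end Roy2013

end Literature.NumberTheory.Transcendental
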